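import Literature.MathematicalPhysics.QuantumManyBody.GroundState
import Literature.MathematicalPhysics.QuantumManyBody.GroundStateFeynmanKacEnergyLower
import HarnessLib

/-!
# Crux `GroundStateRigidity` (stmt-AtomisticToContinuum-9072), line `Sketch`:
# the registered stub `stub_uniqueOfStability`

Supports (does not close) stmt-AtomisticToContinuum-9072. **Uniqueness of the closed-form ground
state from stability, given compactness** (Reed–Simon IV §XIII.12, Thms XIII.46–47, in the
variational language of `GroundState.lean`): IF bounded-energy sequences of trial states are
`L²`-precompact with admissible limits (the registered statement of the neighbouring stub
`stub_compactness`, the FIRST antecedent, not re-proved), `E₀ = groundStateEnergy v N L < ⊤`, and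
STABILITY `(E₀ + κ) ∫ f² ≤ ∫|∇f|² + ∫ V f² + κ (∫_Λ e f)²` holds for real `C¹` Dirichlet `f` with
`κ > 0`, `e ≥ 0` measurable, `∫_Λ e² = 1` (the conclusion of `stub_stabilityOfJensen`, the THIRD
antecedent), THEN `HasUniqueGroundState v N L`. Existence: minimising sequence + compactness
(`IsGroundState.of_tendstoL2`). Key lemma `exists_ae_eq_const_mul`: a ground state `Θ` is `α e`
a.e. on the box, `|α| = 1`, with `α = ⟨e, Θ⟩_{L²(Λ)}` (`|α| ≤ 1` by Cauchy–Schwarz; trial states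
`Φₙ → Θ` with energies frequently `< E₀ + ε` obey `κ(1 − |⟨e, Φₙ⟩|²) < ε` by stability for
`Re Φₙ`, `Im Φₙ`, and `⟨e, Φₙ⟩ → α`; equality in Cauchy–Schwarz). Uniqueness: `α₁ e`, `α₂ e` differ
by the phase `α₂ conj α₁`; the nonnegative ground state is `|Ψ| = e = conj α · Ψ` a.e.
-/

noncomputable section

open MeasureTheory Filter Set
open scoped ENNReal NNReal Topology ComplexConjugate InnerProductSpace

namespace Summit.AtomisticToContinuum.BoseEinsteinCondensation.Theorems.GroundStateRigidity

open Literature.MathematicalPhysics.QuantumManyBody.BoseGas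

namespace UniqueOfStability

variable {N : ℕ}

/-! ### `L²` bookkeeping -/

/-- The `L²` seminorm of a complex function as a power of `∫ |f|²` (any measure). [folklore] -/
theorem eLpNorm_two_eq {α : Type*} [MeasurableSpace α] (μ : Measure α) (f : α → ℂ) :
    eLpNorm f 2 μ = (∫⁻ x, (‖f x‖₊ : ℝ≥0∞) ^ 2 ∂μ) ^ (1 / 2 : ℝ) := by
  rw [eLpNorm_eq_lintegral_rpow_enorm_toReal two_ne_zero ENNReal.ofNat_ne_top,
    ENNReal.toReal_ofNat]
  simp_rw [enorm_eq_nnnorm, ENNReal.rpow_two]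

/-- A normalised measurable function is in `L²` of any restriction of Lebesgue measure.
[folklore] -/
theorem memLp_restrict_of_lintegral_eq_one {Ψ : Config N → ℂ}
    (hm : AEStronglyMeasurable Ψ volume)
    (h1 : ∫⁻ X, (‖Ψ X‖₊ : ℝ≥0∞) ^ 2 = 1) (s : Set (Config N)) :
    MemLp Ψ 2 (volume.restrict s) := by
  refine MemLp.restrict s ⟨hm, ?_⟩
  rw [eLpNorm_two_eq, h1, ENNReal.one_rpow]
  exact ENNReal.one_lt_top

/-- `∫_s e² = 1` as a Bochner integral forces `e²` to be integrable on `s`. [folklore] -/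
theorem integrable_sq_of_integral_eq_one {e : Config N → ℝ} {s : Set (Config N)}
    (h1 : ∫ X in s, e X ^ 2 = 1) : Integrable (fun X => e X ^ 2) (volume.restrict s) := by
  by_contra h
  rw [integral_undef h] at h1
  exact zero_ne_one h1

/-- The complexification of `e` is in `L²(s)`. [folklore] -/
theorem memLp_ofReal {e : Config N → ℝ} (he : Measurable e) {s : Set (Config N)}
    (h1 : ∫ X in s, e X ^ 2 = 1) : MemLp (fun X => (e X : ℂ)) 2 (volume.restrict s) := by
  refine (memLp_two_iff_integrable_sq_norm
    (Complex.measurable_ofReal.comp he).aestronglyMeasurable).2 ?_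
  refine (integrable_sq_of_integral_eq_one h1).congr (Eventually.of_forall fun X => ?_)
  simp only [Function.comp_apply, Complex.norm_real, Real.norm_eq_abs, sq_abs]

/-- `‖e‖_{L²(s)} = 1`. [folklore] -/
theorem norm_toLp_ofReal_eq_one {e : Config N → ℝ} (he : Measurable e) {s : Set (Config N)}
    (h1 : ∫ X in s, e X ^ 2 = 1) :
    ‖(memLp_ofReal he h1).toLp (fun X => (e X : ℂ))‖ = 1 := by
  rw [Lp.norm_toLp, eLpNorm_two_eq]
  have h : ∫⁻ X, (‖(e X : ℂ)‖₊ : ℝ≥0∞) ^ 2 ∂(volume.restrict s) = 1 := by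
    have hpt : ∀ X, (‖(e X : ℂ)‖₊ : ℝ≥0∞) ^ 2 = ENNReal.ofReal (e X ^ 2) := fun X => by
      rw [Complex.nnnorm_real, ← enorm_eq_nnnorm, enorm_sq_eq_ofReal_sq]
    simp_rw [hpt]
    rw [← ofReal_integral_eq_lintegral_ofReal (integrable_sq_of_integral_eq_one h1)
      (Eventually.of_forall fun X => sq_nonneg _), h1, ENNReal.ofReal_one]
  rw [h, ENNReal.one_rpow, ENNReal.toReal_one]

/-- The `L²(s)` pairing of the classes of `e` and `g` is the Bochner integral `∫_s e g`.
[folklore] -/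
theorem inner_toLp_ofReal_eq {e : Config N → ℝ} (he : Measurable e) {s : Set (Config N)}
    (h1 : ∫ X in s, e X ^ 2 = 1) {g : Config N → ℂ} (hg : MemLp g 2 (volume.restrict s)) :
    ⟪(memLp_ofReal he h1).toLp (fun X => (e X : ℂ)), hg.toLp g⟫_ℂ =
      ∫ X in s, (e X : ℂ) * g X := by
  rw [L2.inner_def]
  refine integral_congr_ae ?_
  filter_upwards [(memLp_ofReal he h1).coeFn_toLp, hg.coeFn_toLp] with X h1' h2'
  rw [h1', h2', RCLike.inner_apply', Complex.conj_ofReal]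

/-- **Stability for complex trial states**: if `(E₀ + κ) ∫ f² ≤ ∫|∇f|² + ∫Vf² + κ (∫_Λ e f)²` for
real `C¹` Dirichlet `f`, then every trial state `Φ` of finite energy obeys
`E₀ + κ ≤ ⟨Φ, H_N Φ⟩ + κ |∫_Λ e Φ|²` (add stability for `Re Φ`, `Im Φ`: `∫(Re Φ)² + ∫(Im Φ)² = 1`,
`|∫_Λ e Φ|² = (∫_Λ e Re Φ)² + (∫_Λ e Im Φ)²`, and the four real energy pieces sum to at most the
energy of `Φ`, by superadditivity of `∫⁻`). [cite: ReedSimonIV1978, §XIII.12 Thm XIII.46] -/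
theorem stability_trialState {v : ℝ → ℝ≥0∞} {L : ℝ} {κ : ℝ} {e : Config N → ℝ}
    (he : Measurable e) (he1 : ∫ X in boxN N L, e X ^ 2 = 1)
    (hstab : ∀ f : Config N → ℝ, ContDiff ℝ 1 f → (∀ X, X ∉ boxN N L → f X = 0) →
      ((groundStateEnergy v N L).toReal + κ) * ∫ X, f X ^ 2 ≤
        (∫⁻ X, realKinetic f X).toReal + (∫⁻ X, interaction v X * ‖f X‖ₑ ^ 2).toReal +
          κ * (∫ X in boxN N L, e X * f X) ^ 2)
    (Φ : TrialState N L) (hfin : energy v Φ ≠ ⊤) :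
    (groundStateEnergy v N L).toReal + κ ≤
      (energy v Φ).toReal + κ * ‖∫ X in boxN N L, (e X : ℂ) * Φ.ψ X‖ ^ 2 := by
  obtain ⟨u, hu⟩ : ∃ u : Config N → ℝ, u = fun Y => (Φ.ψ Y).re := ⟨_, rfl⟩
  obtain ⟨w, hw⟩ : ∃ w : Config N → ℝ, w = fun Y => (Φ.ψ Y).im := ⟨_, rfl⟩
  have hux : ∀ X, (Φ.ψ X).re = u X := fun X => by rw [hu]
  have hwx : ∀ X, (Φ.ψ X).im = w X := fun X => by rw [hw]
  have hu1 : ContDiff ℝ 1 u := hu ▸ Complex.reCLM.contDiff.comp Φ.contDiff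
  have hw1 : ContDiff ℝ 1 w := hw ▸ Complex.imCLM.contDiff.comp Φ.contDiff
  have hu0 : ∀ x, x ∉ boxN N L → u x = 0 := fun x hx => by rw [← hux, Φ.eq_zero x hx]; simp
  have hw0 : ∀ x, x ∉ boxN N L → w x = 0 := fun x hx => by rw [← hwx, Φ.eq_zero x hx]; simp
  -- the four real energy pieces sum to at most the energy of `Φ`
  have hle : (∫⁻ x, realKinetic u x) + (∫⁻ x, realKinetic w x) +
      ((∫⁻ x, interaction v x * ‖u x‖ₑ ^ 2) + (∫⁻ x, interaction v x * ‖w x‖ₑ ^ 2)) ≤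
        energy v Φ := by
    unfold energy
    have hpt : ∀ X, kineticDensity Φ.ψ X + interaction v X * (‖Φ.ψ X‖₊ : ℝ≥0∞) ^ 2 =
        (realKinetic u X + realKinetic w X) +
          (interaction v X * ‖u X‖ₑ ^ 2 + interaction v X * ‖w X‖ₑ ^ 2) := by
      intro X
      rw [kineticDensity_eq_realKinetic_add (Φ.contDiff.differentiable one_ne_zero) X, ← hu, ← hw,
        coe_nnnorm_sq_complex_eq_add, ← enorm_eq_nnnorm, ← enorm_eq_nnnorm, hux, hwx]
      ring
    simp_rw [hpt]
    have hm : Measurable fun X => realKinetic u X + realKinetic w X :=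
      (measurable_realKinetic hu1).add (measurable_realKinetic hw1)
    rw [lintegral_add_left hm, lintegral_add_left (measurable_realKinetic hu1)]
    exact add_le_add le_rfl (le_lintegral_add _ _)
  have hT : ∀ {a : ℝ≥0∞}, a ≤ (∫⁻ x, realKinetic u x) + (∫⁻ x, realKinetic w x) +
      ((∫⁻ x, interaction v x * ‖u x‖ₑ ^ 2) + (∫⁻ x, interaction v x * ‖w x‖ₑ ^ 2)) → a ≠ ⊤ :=
    fun ha => ne_top_of_le_ne_top hfin (ha.trans hle)
  have hsum : (∫⁻ x, realKinetic u x).toReal + (∫⁻ x, realKinetic w x).toReal +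
      ((∫⁻ x, interaction v x * ‖u x‖ₑ ^ 2).toReal +
        (∫⁻ x, interaction v x * ‖w x‖ₑ ^ 2).toReal) ≤ (energy v Φ).toReal := by
    have h := ENNReal.toReal_mono hfin hle
    rwa [ENNReal.toReal_add (hT le_self_add) (hT le_add_self),
      ENNReal.toReal_add (hT (le_self_add.trans le_self_add)) (hT (le_add_self.trans le_self_add)),
      ENNReal.toReal_add (hT (le_self_add.trans le_add_self))
        (hT (le_add_self.trans le_add_self))] at h
  -- the normalisation splits: `∫ u² + ∫ w² = 1`
  have hint : ∀ {g : Config N → ℝ}, ContDiff ℝ 1 g → (∀ x, x ∉ boxN N L → g x = 0) →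
      Integrable (fun x => g x ^ 2) volume := fun {g} hg hg0 => by
    have hsupp : HasCompactSupport g :=
      HasCompactSupport.intro' (isBounded_boxN N L).isCompact_closure isClosed_closure
        fun x hx => hg0 x fun h => hx (subset_closure h)
    rw [show (fun x => g x ^ 2) = fun x => g x * g x from funext fun x => sq (g x)]
    exact (hg.continuous.mul hg.continuous).integrable_of_hasCompactSupport hsupp.mul_right
  have hnorm : (∫ x, u x ^ 2) + ∫ x, w x ^ 2 = 1 := by
    have h := Φ.norm_eq
    have hpt : ∀ X, ((‖Φ.ψ X‖₊ : ℝ≥0∞)) ^ 2 =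
        ENNReal.ofReal (u X ^ 2) + ENNReal.ofReal (w X ^ 2) := fun X => by
      rw [coe_nnnorm_sq_complex_eq_add, ← enorm_eq_nnnorm, ← enorm_eq_nnnorm,
        enorm_sq_eq_ofReal_sq, enorm_sq_eq_ofReal_sq, hux, hwx]
    simp_rw [hpt] at h
    rw [lintegral_add_left (hu1.continuous.measurable.pow_const 2).ennreal_ofReal] at h
    have hfu : ∫⁻ x, ENNReal.ofReal (u x ^ 2) ≠ ⊤ :=
      ne_top_of_le_ne_top ENNReal.one_ne_top (le_trans le_self_add h.le)
    have hfw : ∫⁻ x, ENNReal.ofReal (w x ^ 2) ≠ ⊤ :=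
      ne_top_of_le_ne_top ENNReal.one_ne_top (le_trans le_add_self h.le)
    have h' := congrArg ENNReal.toReal h
    rwa [ENNReal.toReal_add hfu hfw, ENNReal.toReal_one, toReal_lintegral_sq (hint hu1 hu0),
      toReal_lintegral_sq (hint hw1 hw0)] at h'
  -- the complex pairing splits: `|∫_Λ e Φ|² = (∫_Λ e u)² + (∫_Λ e w)²`
  have hpair : ‖∫ X in boxN N L, (e X : ℂ) * Φ.ψ X‖ ^ 2 =
      (∫ X in boxN N L, e X * u X) ^ 2 + (∫ X in boxN N L, e X * w X) ^ 2 := by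
    have hΦ2 : MemLp Φ.ψ 2 (volume.restrict (boxN N L)) :=
      memLp_restrict_of_lintegral_eq_one Φ.contDiff.continuous.aestronglyMeasurable Φ.norm_eq _
    have hI : Integrable (fun X => (e X : ℂ) * Φ.ψ X) (volume.restrict (boxN N L)) :=
      memLp_one_iff_integrable.1 (hΦ2.mul' (memLp_ofReal he he1))
    have hre : (∫ X in boxN N L, (e X : ℂ) * Φ.ψ X).re = ∫ X in boxN N L, e X * u X := by
      have h := integral_re hI
      simp only [RCLike.re_to_complex, Complex.re_ofReal_mul] at h
      rw [← h]; exact integral_congr_ae (Eventually.of_forall fun X => by simp only [hux])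
    have him : (∫ X in boxN N L, (e X : ℂ) * Φ.ψ X).im = ∫ X in boxN N L, e X * w X := by
      have h := integral_im hI
      simp only [RCLike.im_to_complex, Complex.im_ofReal_mul] at h
      rw [← h]; exact integral_congr_ae (Eventually.of_forall fun X => by simp only [hwx])
    rw [Complex.sq_norm, Complex.normSq_apply, hre, him]
    ring
  -- combine
  have h1 : ((groundStateEnergy v N L).toReal + κ) * (∫ x, u x ^ 2) +
      ((groundStateEnergy v N L).toReal + κ) * (∫ x, w x ^ 2) =
        (groundStateEnergy v N L).toReal + κ := by
    rw [← mul_add, hnorm, mul_one]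
  rw [hpair, mul_add]
  linarith [hstab u hu1 hu0, hstab w hw1 hw0, hsum, h1]

/-! ### The key lemma: ground states are constant multiples of `e` on the box -/

/-- **Every ground state is a.e. on the box a unimodular multiple of `e`** (`E₀ < ⊤`, stability
with `κ > 0`, `∫_Λ e² = 1`): `α = ⟨e, Θ⟩_{L²(Λ)}` has `|α| ≤ 1` (Cauchy–Schwarz), while trial states
`Φₙ → Θ` with energies frequently `< E₀ + ε` give `κ(1 − |⟨e, Φₙ⟩|²) < ε` and `⟨e, Φₙ⟩ → α`; so
`|α| = 1 = ‖Θ‖` and `Θ = α e` in `L²(Λ)`. [cite: ReedSimonIV1978, §XIII.12 Thm XIII.46] -/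
theorem exists_ae_eq_const_mul {v : ℝ → ℝ≥0∞} {L : ℝ} (hE : groundStateEnergy v N L ≠ ⊤)
    {κ : ℝ} (hκ : 0 < κ) {e : Config N → ℝ} (he : Measurable e)
    (he1 : ∫ X in boxN N L, e X ^ 2 = 1)
    (hstab : ∀ f : Config N → ℝ, ContDiff ℝ 1 f → (∀ X, X ∉ boxN N L → f X = 0) →
      ((groundStateEnergy v N L).toReal + κ) * ∫ X, f X ^ 2 ≤
        (∫⁻ X, realKinetic f X).toReal + (∫⁻ X, interaction v X * ‖f X‖ₑ ^ 2).toReal +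
          κ * (∫ X in boxN N L, e X * f X) ^ 2)
    {Θ : Config N → ℂ} (hΘ : IsGroundState v L Θ) :
    ∃ α : ℂ, ‖α‖ = 1 ∧ ∀ᵐ X ∂(volume.restrict (boxN N L)), Θ X = α * e X := by
  set μ : Measure (Config N) := volume.restrict (boxN N L) with hμ
  have he2 : MemLp (fun X => (e X : ℂ)) 2 μ := memLp_ofReal he he1
  have hΘ2 : MemLp Θ 2 μ :=
    memLp_restrict_of_lintegral_eq_one hΘ.measurable.aestronglyMeasurable hΘ.norm_eq _
  set eH : Lp ℂ 2 μ := he2.toLp (fun X => (e X : ℂ)) with heHdef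
  set ΘH : Lp ℂ 2 μ := hΘ2.toLp Θ with hΘHdef
  have heH1 : ‖eH‖ = 1 := norm_toLp_ofReal_eq_one he he1
  have hΘH1 : ‖ΘH‖ ≤ 1 := by
    rw [hΘHdef, Lp.norm_toLp, ← ENNReal.toReal_one]
    refine ENNReal.toReal_mono ENNReal.one_ne_top ((eLpNorm_restrict_le _ _ _ _).trans_eq ?_)
    rw [eLpNorm_two_eq, hΘ.norm_eq, ENNReal.one_rpow]
  set α : ℂ := ⟪eH, ΘH⟫_ℂ with hαdef
  have hαle : ‖α‖ ≤ 1 :=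
    (norm_inner_le_norm eH ΘH).trans (by rw [heH1, one_mul]; exact hΘH1)
  -- the variational lower bound: `κ (1 - |α|²) ≤ ε` for every `ε > 0`
  have hlow : κ * (1 - ‖α‖ ^ 2) ≤ 0 := by
    refine le_of_forall_pos_le_add fun ε hε => ?_
    rw [zero_add]
    have hlt : closedEnergy v L Θ < groundStateEnergy v N L + ENNReal.ofReal ε := by
      rw [hΘ.closedEnergy_eq]
      exact ENNReal.lt_add_right hE (ENNReal.ofReal_pos.2 hε).ne'
    obtain ⟨Φ, hΦ⟩ := iInf_lt_iff.1 hlt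
    obtain ⟨hΦΘ, hlim⟩ := iInf_lt_iff.1 hΦ
    have hfreq : ∃ᶠ n in atTop, energy v (Φ n) < groundStateEnergy v N L + ENNReal.ofReal ε :=
      frequently_lt_of_liminf_lt (by isBoundedDefault) hlim
    have hΦ2 : ∀ n, MemLp (Φ n).ψ 2 μ := fun n =>
      memLp_restrict_of_lintegral_eq_one (Φ n).contDiff.continuous.aestronglyMeasurable
        (Φ n).norm_eq _
    have hconv : Tendsto (fun n => (hΦ2 n).toLp (Φ n).ψ) atTop (𝓝 ΘH) := by
      rw [tendsto_iff_edist_tendsto_0]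
      have hb : ∀ n, edist ((hΦ2 n).toLp (Φ n).ψ) ΘH ≤
          (∫⁻ X, (‖(Φ n).ψ X - Θ X‖₊ : ℝ≥0∞) ^ 2) ^ (1 / 2 : ℝ) := fun n => by
        rw [hΘHdef, Lp.edist_toLp_toLp]
        refine (eLpNorm_restrict_le _ _ _ _).trans_eq ?_
        rw [eLpNorm_two_eq]
        rfl
      have h' : Tendsto (fun n => (∫⁻ X, (‖(Φ n).ψ X - Θ X‖₊ : ℝ≥0∞) ^ 2) ^ (1 / 2 : ℝ))
          atTop (𝓝 ((0 : ℝ≥0∞) ^ (1 / 2 : ℝ))) :=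
        (ENNReal.continuous_rpow_const.tendsto 0).comp hΦΘ
      rw [ENNReal.zero_rpow_of_pos (by norm_num)] at h'
      exact tendsto_of_tendsto_of_tendsto_of_le_of_le tendsto_const_nhds h' (fun _ => zero_le) hb
    have hβ : Tendsto (fun n => ⟪eH, (hΦ2 n).toLp (Φ n).ψ⟫_ℂ) atTop (𝓝 α) :=
      Filter.Tendsto.inner (𝕜 := ℂ) tendsto_const_nhds hconv
    have hg : Tendsto (fun n => κ * (1 - ‖⟪eH, (hΦ2 n).toLp (Φ n).ψ⟫_ℂ‖ ^ 2)) atTop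
        (𝓝 (κ * (1 - ‖α‖ ^ 2))) :=
      ((hβ.norm.pow 2).const_sub 1).const_mul κ
    -- along the good indices, `κ (1 - |⟨e, Φₙ⟩|²) < ε`
    have hfreq' : ∃ᶠ n in atTop, κ * (1 - ‖⟪eH, (hΦ2 n).toLp (Φ n).ψ⟫_ℂ‖ ^ 2) ∈ Iic ε := by
      refine hfreq.mono fun n hn => ?_
      have hS := stability_trialState he he1 hstab (Φ n) (ne_top_of_lt hn)
      rw [← inner_toLp_ofReal_eq he he1 (hΦ2 n)] at hS
      have hlt' : (energy v (Φ n)).toReal < (groundStateEnergy v N L).toReal + ε := by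
        have h := ENNReal.toReal_strict_mono
          (ENNReal.add_ne_top.2 ⟨hE, ENNReal.ofReal_ne_top⟩) hn
        rwa [ENNReal.toReal_add hE ENNReal.ofReal_ne_top, ENNReal.toReal_ofReal hε.le] at h
      show _ ≤ ε
      linarith [hS, hlt']
    exact isClosed_Iic.mem_of_frequently_of_tendsto hfreq' hg
  have hα2 : 1 ≤ ‖α‖ ^ 2 := by nlinarith [hlow, hκ]
  have hα : ‖α‖ = 1 := le_antisymm hαle (by nlinarith [hα2, norm_nonneg α])
  have hΘ1 : ‖ΘH‖ = 1 := by
    have h := norm_inner_le_norm (𝕜 := ℂ) eH ΘH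
    rw [heH1, one_mul, ← hαdef, hα] at h
    exact le_antisymm hΘH1 h
  -- equality case of Cauchy–Schwarz: `Θ = α e` in `L²(Λ)`
  have hEq : α • eH = ΘH := by
    have h1 : ‖α • eH‖ = 1 := by rw [norm_smul, hα, heH1, one_mul]
    have h2 : ⟪α • eH, ΘH⟫_ℂ = 1 := by
      rw [inner_smul_left, ← hαdef, Complex.conj_mul', hα]
      simp
    exact (inner_eq_one_iff_of_norm_eq_one h1 hΘ1).1 h2
  have hae : (ΘH : Config N → ℂ) =ᵐ[μ] fun X => α * (eH : Config N → ℂ) X := by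
    rw [← hEq]
    filter_upwards [Lp.coeFn_smul α eH] with X hX
    rw [hX, Pi.smul_apply, smul_eq_mul]
  refine ⟨α, hα, ?_⟩
  filter_upwards [hΘ2.coeFn_toLp, he2.coeFn_toLp, hae] with X h1 h2 h3
  rw [← h1, h3, h2]

/-- **The nonnegative ground state**: if a ground state `Ψ` equals `α e` a.e. on the box,
`|α| = 1`, `e ≥ 0`, then `|Ψ| = e = conj α · Ψ` a.e. is a ground state (`conj α · Ψ` is one by phase
invariance; the closed energy only sees the a.e. class). [cite: ReedSimonIV1978, Thm XIII.47] -/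
theorem isGroundState_norm {v : ℝ → ℝ≥0∞} {L : ℝ} {Ψ : Config N → ℂ} (hΨ : IsGroundState v L Ψ)
    {α : ℂ} (hα : ‖α‖ = 1) {e : Config N → ℝ} (he0 : ∀ X, 0 ≤ e X)
    (hae : ∀ᵐ X ∂(volume.restrict (boxN N L)), Ψ X = α * e X) :
    IsGroundState v L (fun X => ((‖Ψ X‖ : ℝ) : ℂ)) := by
  have hc : ‖conj α‖ = 1 := by rw [Complex.norm_conj, hα]
  have hG := hΨ.const_mul hc
  -- `|Ψ| = conj α · Ψ` a.e.
  have h : (fun X => ((‖Ψ X‖ : ℝ) : ℂ)) =ᵐ[volume] fun X => conj α * Ψ X := by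
    have h1 : ∀ᵐ X : Config N, X ∈ boxN N L → Ψ X = α * e X :=
      (ae_restrict_iff' (measurableSet_boxN N L)).1 hae
    filter_upwards [h1] with X hX
    by_cases hmem : X ∈ boxN N L
    · rw [hX hmem, norm_mul, hα, one_mul, Complex.norm_real, Real.norm_eq_abs,
        abs_of_nonneg (he0 X), ← mul_assoc, Complex.conj_mul', hα]
      simp
    · simp [hΨ.eq_zero X hmem]
  -- the closed energy only depends on the a.e. class
  have heq : closedEnergy v L (fun X => ((‖Ψ X‖ : ℝ) : ℂ)) =
      closedEnergy v L fun X => conj α * Ψ X := by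
    have hiff : ∀ Φ : ℕ → TrialState N L,
        TendstoL2 Φ (fun X => ((‖Ψ X‖ : ℝ) : ℂ)) ↔ TendstoL2 Φ fun X => conj α * Ψ X := fun Φ => by
      have he : ∀ n, ∫⁻ X, (‖(Φ n).ψ X - ((‖Ψ X‖ : ℝ) : ℂ)‖₊ : ℝ≥0∞) ^ 2 =
          ∫⁻ X, (‖(Φ n).ψ X - conj α * Ψ X‖₊ : ℝ≥0∞) ^ 2 :=
        fun n => lintegral_congr_ae (h.mono fun X hX => by simp only [hX])
      simp only [TendstoL2, he]
    simp only [closedEnergy, hiff]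
  refine ⟨Complex.measurable_ofReal.comp hΨ.measurable.norm, fun X hX => by simp [hΨ.eq_zero X hX],
    fun σ X => by simp only [hΨ.symm σ X], ?_, ?_⟩
  · rw [heq]; exact hG.closedEnergy_ne_top
  · rw [heq]; exact hG.closedEnergy_eq

/-- **Existence of a ground state from compactness**: a minimising sequence of trial states
(energies `< E₀ + 1/(n+1)`) has an `L²`-convergent subsequence whose admissible limit is a ground
state (`IsGroundState.of_tendstoL2`). [cite: ReedSimonIV1978, Thm XIII.64] -/
theorem exists_isGroundState
    (hC : ∀ (N : ℕ) (L : ℝ) (v : ℝ → ℝ≥0∞) (E : ℝ≥0∞) (Φ : ℕ → TrialState N L), E ≠ ⊤ →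
      (∀ n, energy v (Φ n) ≤ E) →
      ∃ (Ψ : Config N → ℂ) (φ : ℕ → ℕ), StrictMono φ ∧ Measurable Ψ ∧
        (∀ X, X ∉ boxN N L → Ψ X = 0) ∧
        (∀ (σ : Equiv.Perm (Fin N)) (X : Config N), Ψ (X ∘ σ) = Ψ X) ∧
        TendstoL2 (fun n => Φ (φ n)) Ψ)
    {v : ℝ → ℝ≥0∞} {L : ℝ} (hE : groundStateEnergy v N L ≠ ⊤) :
    ∃ Ψ : Config N → ℂ, IsGroundState v L Ψ := by
  have hex : ∀ n : ℕ, ∃ Φ : TrialState N L,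
      energy v Φ < groundStateEnergy v N L + ((n + 1 : ℕ) : ℝ≥0∞)⁻¹ := fun n =>
    iInf_lt_iff.1 (ENNReal.lt_add_right hE (ENNReal.inv_pos.2 (ENNReal.natCast_ne_top _)).ne')
  choose Φ hΦ using hex
  have hEtop : groundStateEnergy v N L + 1 ≠ ⊤ := ENNReal.add_ne_top.2 ⟨hE, ENNReal.one_ne_top⟩
  obtain ⟨Ψ, φ, hφ, hm, h0, hσ, hL2⟩ := hC N L v _ Φ hEtop fun n => (hΦ n).le.trans
    (add_le_add le_rfl (ENNReal.inv_le_one.2 (by exact_mod_cast Nat.le_add_left 1 n)))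
  have hup : Tendsto (fun n => groundStateEnergy v N L + ((φ n + 1 : ℕ) : ℝ≥0∞)⁻¹) atTop
      (𝓝 (groundStateEnergy v N L)) := by
    have h := ((ENNReal.tendsto_inv_nat_nhds_zero.comp (tendsto_add_atTop_nat 1)).comp
      hφ.tendsto_atTop).const_add (groundStateEnergy v N L)
    rwa [add_zero] at h
  have hlim : liminf (fun n => energy v (Φ (φ n))) atTop ≤ groundStateEnergy v N L :=
    (liminf_le_liminf (Eventually.of_forall fun n => (hΦ (φ n)).le)).trans hup.liminf_eq.le
  exact ⟨Ψ, IsGroundState.of_tendstoL2 hm h0 hσ hE hL2 hlim⟩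

end UniqueOfStability

/-! ### The stub -/

open UniqueOfStability in
/-- **Stub `stub_uniqueOfStability` of line `Sketch` — uniqueness of the closed-form ground state
from stability, given compactness.** If bounded-energy sequences of trial states are
`L²`-precompact with admissible limits (the registered statement of `stub_compactness`),
`E₀ = groundStateEnergy v N L < ⊤`, and `(E₀ + κ) ∫ f² ≤ ∫|∇f|² + ∫Vf² + κ (∫_Λ e f)²` for real `C¹`
Dirichlet `f` (`κ > 0`, `e ≥ 0` measurable, `∫_Λ e² = 1`), then `HasUniqueGroundState v N L`:
a ground state exists (minimising sequence + compactness), every ground state is `α e` a.e. on the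
box with `|α| = 1` (`exists_ae_eq_const_mul`), so two ground states differ by a phase and
`|Ψ| = conj α · Ψ` a.e. is a nonnegative one.
[cite: ReedSimonIV1978, §XIII.12 Thms XIII.46–XIII.47] -/
theorem stub_uniqueOfStability :
    (∀ (N : ℕ) (L : ℝ) (v : ℝ → ℝ≥0∞) (E : ℝ≥0∞) (Φ : ℕ → TrialState N L), E ≠ ⊤ →
      (∀ n, energy v (Φ n) ≤ E) →
      ∃ (Ψ : Config N → ℂ) (φ : ℕ → ℕ), StrictMono φ ∧ Measurable Ψ ∧
        (∀ X, X ∉ boxN N L → Ψ X = 0) ∧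
        (∀ (σ : Equiv.Perm (Fin N)) (X : Config N), Ψ (X ∘ σ) = Ψ X) ∧
        TendstoL2 (fun n => Φ (φ n)) Ψ) →
    ∀ (N : ℕ) (v : ℝ → ℝ≥0∞) (L : ℝ), groundStateEnergy v N L ≠ ⊤ →
      (∃ κ : ℝ, 0 < κ ∧ ∃ e : Config N → ℝ, Measurable e ∧ (∀ X, 0 ≤ e X) ∧
        ∫ X in boxN N L, e X ^ 2 = 1 ∧
        ∀ f : Config N → ℝ, ContDiff ℝ 1 f → (∀ X, X ∉ boxN N L → f X = 0) →
          ((groundStateEnergy v N L).toReal + κ) * ∫ X, f X ^ 2 ≤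
            (∫⁻ X, realKinetic f X).toReal + (∫⁻ X, interaction v X * ‖f X‖ₑ ^ 2).toReal +
              κ * (∫ X in boxN N L, e X * f X) ^ 2) →
      HasUniqueGroundState v N L := by
  intro hC N v L hE ⟨κ, hκ, e, he, he0, he1, hstab⟩
  -- existence of a ground state, and its representation `Ψ = α e` on the box
  obtain ⟨Ψ, hΨ⟩ := exists_isGroundState (N := N) hC hE
  obtain ⟨α, hα, hae⟩ := exists_ae_eq_const_mul hE hκ he he1 hstab hΨ
  refine ⟨⟨fun X => ‖Ψ X‖, fun X => norm_nonneg _, isGroundState_norm hΨ hα he0 hae⟩,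
    fun Ψ₁ Ψ₂ h₁ h₂ => ?_⟩
  -- uniqueness up to phase: `Ψ₁ = α₁ e`, `Ψ₂ = α₂ e` on the box, both vanish off it
  obtain ⟨α₁, hα₁, hae₁⟩ := exists_ae_eq_const_mul hE hκ he he1 hstab h₁
  obtain ⟨α₂, hα₂, hae₂⟩ := exists_ae_eq_const_mul hE hκ he he1 hstab h₂
  refine ⟨α₂ * conj α₁, by rw [norm_mul, Complex.norm_conj, hα₁, hα₂, mul_one], ?_⟩
  filter_upwards [(ae_restrict_iff' (measurableSet_boxN N L)).1 (hae₁.and hae₂)] with X hX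
  by_cases hmem : X ∈ boxN N L
  · obtain ⟨e1, e2⟩ := hX hmem
    rw [e1, e2, mul_assoc, ← mul_assoc (conj α₁), Complex.conj_mul', hα₁]
    simp
  · rw [h₁.eq_zero X hmem, h₂.eq_zero X hmem, mul_zero]

end Summit.AtomisticToContinuum.BoseEinsteinCondensation.Theorems.GroundStateRigidity

end
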